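import Mathlib.RingTheory.Henselian
import Mathlib.RingTheory.AdicCompletion.Completeness
import Mathlib.RingTheory.PowerSeries.Inverse
import Mathlib.RingTheory.PowerSeries.Trunc
import Mathlib.RingTheory.Polynomial.Basic
import Mathlib.Algebra.Polynomial.Roots
import Mathlib.Algebra.Polynomial.Lifts
import HarnessLib

/-!
# Towards Kaltofen's Theorem 7 (effective Noether forms): proofs, part 2 — Hensel splitting
# and irreducibility over extension fields

Sibling proof file of `KaltofenNoetherForms.lean` (E. Kaltofen, *Effective Noether
irreducibility forms and applications*, J. Comput. System Sci. 50 (1995) 274–295), providing the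
abstract algebra behind Lemma 7 / Theorem 5 (§4–5): a polynomial `P ∈ A[Y][X]` over a domain
`A` which is irreducible, has a unit constant leading `X`-coefficient, and whose reduction
`P(X, 0) ∈ A[X]` has `deg_X P` simple roots in `A`, stays irreducible in `Ω[Y][X]` for every
field `Ω` into which `A` embeds (`irreducible_map_of_irreducible_of_simple_roots`).

This replaces, for the purpose of Lemma 7, Kaltofen's appeal to the algorithm
"Factorization over the Coefficient Field" (proof of Thm. 5, p. 20: "the root `ζ₁` used to
construct the extension field `L₁` of that algorithm is actually an element in `K̄`. Hence
`L₁ ⊂ K̄(z₂, …, zₙ)`"): by Hensel's lemma in `A⟦Y⟧` all `X`-roots of `P` are power series in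
`Y` over `A` (`eq_prod_X_sub_C_of_simple_roots`), so every monic factor of `P` over any `Ω`
has coefficients in `A[Y]` (`exists_subset_of_monic_dvd_prod`, `exists_map_mapRingHom_eq`),
and a factorisation over `Ω` descends to `A[Y][X]`.

No definitions, no named facts; Mathlib only.

## References

* E. Kaltofen, J. Comput. System Sci. 50 (1995) 274–295, §4 Thm. 5, §5 Lemma 7. [Kaltofen1995]
-/

noncomputable section

open Polynomial

namespace Literature.RingTheory.MvPolynomial

/-! ### Hensel lifting of simple roots to power-series roots -/

/-- Constant coefficient of a value `Q(C ζ)` of `Q ∈ A⟦Y⟧[X]` at a constant: it is the value at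
`ζ` of the reduction of `Q` modulo `Y`. [folklore] -/
theorem constantCoeff_eval_C {A : Type*} [CommRing A] (Q : Polynomial (PowerSeries A)) (ζ : A) :
    PowerSeries.constantCoeff (Q.eval (PowerSeries.C ζ)) =
      (Q.map (PowerSeries.constantCoeff (R := A))).eval ζ := by
  rw [Polynomial.eval_map, ← Polynomial.eval₂_at_apply, PowerSeries.constantCoeff_C]

/-- **Hensel's lemma in `A⟦Y⟧`:** a simple root `ζ ∈ A` of the reduction modulo `Y` of a monic
`P ∈ A⟦Y⟧[X]` lifts to a root `α ∈ A⟦Y⟧` of `P` with constant coefficient `ζ`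
(Mathlib: `A⟦Y⟧` is `Y`-adically complete, hence Henselian). [folklore] -/
theorem exists_root_powerSeries_of_simple_root {A : Type*} [CommRing A]
    (P : Polynomial (PowerSeries A)) (hP : P.Monic) (ζ : A)
    (h0 : (P.map (PowerSeries.constantCoeff (R := A))).IsRoot ζ)
    (h1 : IsUnit ((P.map (PowerSeries.constantCoeff (R := A))).derivative.eval ζ)) :
    ∃ α : PowerSeries A, P.IsRoot α ∧ PowerSeries.constantCoeff α = ζ := by
  have hH : HenselianRing (PowerSeries A) (Ideal.span {PowerSeries.X}) := inferInstance
  have hmem : P.eval (PowerSeries.C ζ) ∈ Ideal.span {(PowerSeries.X : PowerSeries A)} := by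
    rw [Ideal.mem_span_singleton, PowerSeries.X_dvd_iff, constantCoeff_eval_C]
    exact h0
  have hunit : IsUnit (Ideal.Quotient.mk (Ideal.span {(PowerSeries.X : PowerSeries A)})
      (P.derivative.eval (PowerSeries.C ζ))) := by
    refine IsUnit.map _ (PowerSeries.isUnit_iff_constantCoeff.2 ?_)
    rw [constantCoeff_eval_C, ← Polynomial.derivative_map]
    exact h1
  obtain ⟨α, hroot, hα⟩ := hH.is_henselian P hP (PowerSeries.C ζ) hmem hunit
  refine ⟨α, hroot, ?_⟩
  rw [Ideal.mem_span_singleton, PowerSeries.X_dvd_iff, map_sub, PowerSeries.constantCoeff_C,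
    sub_eq_zero] at hα
  exact hα

/-- **Hensel splitting.** Over a domain `A`, a monic `P ∈ A⟦Y⟧[X]` of degree `d` whose
reduction modulo `Y` has `d` simple roots `S ⊂ A` splits into linear factors in `A⟦Y⟧[X]`,
one root above each `ζ ∈ S`. [folklore] -/
theorem eq_prod_X_sub_C_of_simple_roots {A : Type*} [CommRing A] [IsDomain A]
    (P : Polynomial (PowerSeries A)) (hP : P.Monic) (S : Finset A) (hS : S.card = P.natDegree)
    (h0 : ∀ ζ ∈ S, (P.map (PowerSeries.constantCoeff (R := A))).IsRoot ζ)
    (h1 : ∀ ζ ∈ S, IsUnit ((P.map (PowerSeries.constantCoeff (R := A))).derivative.eval ζ)) :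
    ∃ α : A → PowerSeries A, (∀ ζ ∈ S, PowerSeries.constantCoeff (α ζ) = ζ) ∧
      P = ∏ ζ ∈ S, (Polynomial.X - Polynomial.C (α ζ)) := by
  classical
  choose! α hroot hcc using fun ζ (hζ : ζ ∈ S) =>
    exists_root_powerSeries_of_simple_root P hP ζ (h0 ζ hζ) (h1 ζ hζ)
  refine ⟨α, hcc, ?_⟩
  have hP0 : P ≠ 0 := hP.ne_zero
  have hnodup : (S.val.map α).Nodup :=
    Multiset.Nodup.map_on (fun a ha b hb hab => by rw [← hcc a ha, ← hcc b hb, hab]) S.nodup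
  have hle : S.val.map α ≤ P.roots := by
    rw [Multiset.le_iff_subset hnodup]
    intro x hx
    obtain ⟨ζ, hζ, rfl⟩ := Multiset.mem_map.1 hx
    exact (Polynomial.mem_roots hP0).2 (hroot ζ hζ)
  have heq : S.val.map α = P.roots :=
    Multiset.eq_of_le_of_card_le hle
      ((Polynomial.card_roots' P).trans (by rw [← hS, Multiset.card_map, Finset.card_val]))
  have hcard : Multiset.card P.roots = P.natDegree := by
    rw [← heq, Multiset.card_map, Finset.card_val, hS]
  have h := Polynomial.prod_multiset_X_sub_C_of_monic_of_roots_card_eq hP hcard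
  rw [← heq, Multiset.map_map, Function.comp_def] at h
  rw [Finset.prod_eq_multiset_prod]
  exact h.symm

/-! ### Monic divisors of a split polynomial -/

/-- Over a domain, a monic divisor of `∏_{i ∈ S} (X - aᵢ)` with the `aᵢ` distinct is a
sub-product `∏_{i ∈ S'} (X - aᵢ)`. [folklore] -/
theorem exists_subset_of_monic_dvd_prod {R : Type*} [CommRing R] [IsDomain R] {ι : Type*}
    (S : Finset ι) (a : ι → R) (ha : Set.InjOn a S) {q : Polynomial R} (hq : q.Monic)
    (hdvd : q ∣ ∏ i ∈ S, (Polynomial.X - Polynomial.C (a i))) :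
    ∃ S' ⊆ S, q = ∏ i ∈ S', (Polynomial.X - Polynomial.C (a i)) := by
  classical
  set p : Polynomial R := ∏ i ∈ S, (Polynomial.X - Polynomial.C (a i)) with hp_def
  have hp : p.Monic := Polynomial.monic_prod_of_monic _ _ fun i _ => Polynomial.monic_X_sub_C (a i)
  have hp0 : p ≠ 0 := hp.ne_zero
  have hproots : p.roots = S.val.map a := by
    have h := Polynomial.roots_multiset_prod_X_sub_C (S.val.map a)
    rwa [Multiset.map_map, Function.comp_def, ← Finset.prod_eq_multiset_prod] at h
  have hpdeg : p.natDegree = S.card := by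
    rw [hp_def, Polynomial.natDegree_prod_of_monic _ _ fun i _ => Polynomial.monic_X_sub_C (a i)]
    simp
  obtain ⟨r, hr⟩ := hdvd
  have hrm : r.Monic := hq.of_mul_monic_left (hr ▸ hp)
  have hcard : Multiset.card q.roots = q.natDegree := by
    have h1 : p.roots = q.roots + r.roots := by rw [hr]; exact Polynomial.roots_mul (hr ▸ hp0)
    have h2 : p.natDegree = q.natDegree + r.natDegree := by rw [hr, hq.natDegree_mul hrm]
    have h3 : Multiset.card p.roots = p.natDegree := by
      rw [hproots, Multiset.card_map, Finset.card_val, hpdeg]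
    have h4 := Polynomial.card_roots' q
    have h5 := Polynomial.card_roots' r
    rw [h1, Multiset.card_add, h2] at h3
    omega
  have hqle : q.roots ≤ S.val.map a := hproots ▸ Polynomial.roots.le_of_dvd hp0 ⟨r, hr⟩
  have hSnodup : (S.val.map a).Nodup := Multiset.Nodup.map_on (fun x hx y hy h => ha hx hy h) S.nodup
  set S' : Finset ι := S.filter fun i => a i ∈ q.roots with hS'
  refine ⟨S', Finset.filter_subset _ _, ?_⟩
  have hS'val : S'.val.map a = q.roots := by
    rw [hS', Finset.filter_val]
    change Multiset.map a (Multiset.filter ((fun x => x ∈ q.roots) ∘ a) S.val) = _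
    rw [← Multiset.filter_map]
    refine Multiset.Nodup.ext (Multiset.Nodup.filter _ hSnodup) (Multiset.nodup_of_le hqle hSnodup)
      |>.2 fun x => ?_
    rw [Multiset.mem_filter]
    exact ⟨fun h => h.2, fun h => ⟨Multiset.subset_of_le hqle h, h⟩⟩
  have h := Polynomial.prod_multiset_X_sub_C_of_monic_of_roots_card_eq hq hcard
  rw [← hS'val, Multiset.map_map, Function.comp_def] at h
  rw [Finset.prod_eq_multiset_prod]
  exact h.symm

/-! ### Polynomials versus power series under an injective base change -/

/-- Coercion `A[Y] → A⟦Y⟧` commutes with base change along `ι : A → Ω`. [folklore] -/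
theorem powerSeries_map_comp_coe {A Ω : Type*} [CommSemiring A] [CommSemiring Ω] (ι : A →+* Ω) :
    (PowerSeries.map ι).comp (Polynomial.coeToPowerSeries.ringHom (R := A)) =
      (Polynomial.coeToPowerSeries.ringHom (R := Ω)).comp (Polynomial.mapRingHom ι) := by
  refine RingHom.ext fun p => PowerSeries.ext fun m => ?_
  simp [PowerSeries.coeff_map, Polynomial.coeff_coe, Polynomial.coeToPowerSeries.ringHom_apply]

/-- Reduction modulo `Y` of `A[Y] ⊂ A⟦Y⟧` is evaluation at `Y = 0`. [folklore] -/
theorem constantCoeff_comp_coe {A : Type*} [CommSemiring A] :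
    (PowerSeries.constantCoeff (R := A)).comp (Polynomial.coeToPowerSeries.ringHom (R := A)) =
      Polynomial.evalRingHom 0 := by
  refine RingHom.ext fun p => ?_
  simp [Polynomial.coeToPowerSeries.ringHom_apply, Polynomial.constantCoeff_coe,
    Polynomial.coeff_zero_eq_eval_zero]

/-- **Descent of coefficients.** Let `ι : A → Ω` be injective, `Q ∈ Ω[Y][X]` and
`q₀ ∈ A⟦Y⟧[X]` with the same image in `Ω⟦Y⟧[X]`. Then `Q` (and `q₀`) come from a polynomial
`Q₀ ∈ A[Y][X]`. [folklore] -/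
theorem exists_map_mapRingHom_eq {A Ω : Type*} [CommRing A] [CommRing Ω] (ι : A →+* Ω)
    (hι : Function.Injective ι) (Q : Polynomial (Polynomial Ω)) (q₀ : Polynomial (PowerSeries A))
    (h : Q.map (Polynomial.coeToPowerSeries.ringHom (R := Ω)) = q₀.map (PowerSeries.map ι)) :
    ∃ Q₀ : Polynomial (Polynomial A), Q₀.map (Polynomial.mapRingHom ι) = Q ∧
      Q₀.map (Polynomial.coeToPowerSeries.ringHom (R := A)) = q₀ := by
  have hlift : Q ∈ Polynomial.lifts (Polynomial.mapRingHom ι) := by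
    rw [Polynomial.lifts_iff_coeff_lifts]
    intro k
    have hk : ((Q.coeff k : Polynomial Ω) : PowerSeries Ω) = PowerSeries.map ι (q₀.coeff k) := by
      have := congrArg (fun P => Polynomial.coeff P k) h
      simpa [Polynomial.coeff_map, Polynomial.coeToPowerSeries.ringHom_apply] using this
    change Q.coeff k ∈ Set.range (Polynomial.map ι)
    rw [Set.mem_range, ← Polynomial.mem_lifts, Polynomial.lifts_iff_coeff_lifts]
    intro m
    refine ⟨PowerSeries.coeff m (q₀.coeff k), ?_⟩
    rw [← PowerSeries.coeff_map, ← hk, Polynomial.coeff_coe]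
  obtain ⟨Q₀, hQ₀⟩ := (Polynomial.mem_lifts _).1 hlift
  refine ⟨Q₀, hQ₀, ?_⟩
  apply Polynomial.map_injective (PowerSeries.map ι) (PowerSeries.map_injective ι hι)
  rw [Polynomial.map_map, powerSeries_map_comp_coe, ← Polynomial.map_map, hQ₀, h]

/-! ### Irreducibility over extension fields -/

/-- A polynomial over a domain whose leading coefficient is a unit and which is not a unit has
positive degree. [folklore] -/
theorem natDegree_pos_of_not_isUnit {R : Type*} [CommRing R] [IsDomain R] {G : Polynomial R}
    (hlc : IsUnit G.leadingCoeff) (hG : ¬ IsUnit G) : 0 < G.natDegree := by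
  by_contra h
  have h0 : G.natDegree = 0 := by omega
  apply hG
  rw [Polynomial.eq_C_of_natDegree_eq_zero h0]
  refine Polynomial.isUnit_C.2 ?_
  have : G.leadingCoeff = G.coeff 0 := by rw [Polynomial.leadingCoeff, h0]
  rwa [this] at hlc

/-- **Irreducibility persists over every field containing `A` when `P(X, 0)` has simple roots in
`A`** (the algebra of Kaltofen 1995, Thm. 5 / Lemma 7). Let `A` be a domain and `P ∈ A[Y][X]`
irreducible with leading `X`-coefficient a unit constant `ℓ ∈ Aˣ`, and suppose the reduction
`P(X, 0) ∈ A[X]` has `deg_X P` roots `S ⊂ A` which are simple (the derivative is a unit at each).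
Then for every field `Ω` and every injective `ι : A → Ω` the image of `P` in `Ω[Y][X]` is
irreducible. Proof: by Hensel's lemma `ℓ⁻¹P = ∏_{ζ ∈ S} (X - α_ζ)` in `A⟦Y⟧[X]`; a
factorisation `P = G H` over `Ω` has (after normalisation) monic factors dividing this product
in `Ω⟦Y⟧[X]`, hence sub-products, hence with coefficients in `ι(A)⟦Y⟧ ∩ Ω[Y] = ι(A[Y])`;
so the factorisation descends to `A[Y][X]`, contradicting irreducibility.
[cite: Kaltofen1995, §4 Thm. 5 and §5 Lemma 7 (proof)] -/
theorem irreducible_map_of_irreducible_of_simple_roots {A : Type*} [CommRing A] [IsDomain A]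
    {P : Polynomial (Polynomial A)} (hirr : Irreducible P) {ℓ : A} (hℓ : IsUnit ℓ)
    (hlc : P.leadingCoeff = Polynomial.C ℓ) (S : Finset A) (hS : S.card = P.natDegree)
    (h0 : ∀ ζ ∈ S, (P.map (Polynomial.evalRingHom (0 : A))).IsRoot ζ)
    (h1 : ∀ ζ ∈ S, IsUnit ((P.map (Polynomial.evalRingHom (0 : A))).derivative.eval ζ))
    {Ω : Type*} [Field Ω] (ι : A →+* Ω) (hι : Function.Injective ι) :
    Irreducible (P.map (Polynomial.mapRingHom ι)) := by
  classical
  -- notation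
  set coeA : Polynomial A →+* PowerSeries A := Polynomial.coeToPowerSeries.ringHom with hcoeA
  set coeΩ : Polynomial Ω →+* PowerSeries Ω := Polynomial.coeToPowerSeries.ringHom with hcoeΩ
  set j : PowerSeries A →+* PowerSeries Ω := PowerSeries.map ι with hj
  set ιY : Polynomial A →+* Polynomial Ω := Polynomial.mapRingHom ι with hιY
  have hιY_inj : Function.Injective ιY := Polynomial.map_injective ι hι
  have hιYX_inj : Function.Injective (Polynomial.map ιY) := Polynomial.map_injective ιY hιY_inj
  obtain ⟨u, hu⟩ := hℓ
  have hP0 : P ≠ 0 := hirr.ne_zero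
  have hd : 0 < P.natDegree := by
    -- an irreducible polynomial with unit leading coefficient is not a constant
    refine natDegree_pos_of_not_isUnit (by rw [hlc, ← hu]; exact (Units.isUnit u).map _) hirr.not_isUnit
  -- the monic version `Pm = ℓ⁻¹ P` and its power-series image
  set Pm : Polynomial (Polynomial A) := Polynomial.C (Polynomial.C (↑u⁻¹ : A)) * P with hPm
  have hPm_monic : Pm.Monic := by
    refine Polynomial.monic_C_mul_of_mul_leadingCoeff_eq_one ?_
    rw [hlc, ← Polynomial.C_mul, ← hu, Units.inv_mul, Polynomial.C_1]
  have hPm_deg : Pm.natDegree = P.natDegree := by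
    rw [hPm, Polynomial.natDegree_C_mul]
    exact Polynomial.C_ne_zero.2 (Units.ne_zero _)
  set Phat : Polynomial (PowerSeries A) := Pm.map coeA with hPhat
  have hPhat_monic : Phat.Monic := hPm_monic.map _
  have hPhat_deg : Phat.natDegree = P.natDegree := by
    rw [hPhat, hPm_monic.natDegree_map, hPm_deg]
  -- reduction of `Phat` modulo `Y` is `ℓ⁻¹ P(X, 0)`
  have hred : Phat.map (PowerSeries.constantCoeff (R := A)) =
      Polynomial.C (↑u⁻¹ : A) * P.map (Polynomial.evalRingHom (0 : A)) := by
    rw [hPhat, Polynomial.map_map, hcoeA, constantCoeff_comp_coe, hPm, Polynomial.map_mul,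
      Polynomial.map_C]
    simp
  have h0' : ∀ ζ ∈ S, (Phat.map (PowerSeries.constantCoeff (R := A))).IsRoot ζ := by
    intro ζ hζ
    rw [hred, Polynomial.IsRoot, Polynomial.eval_mul, Polynomial.eval_C, (h0 ζ hζ).eq_zero, mul_zero]
  have h1' : ∀ ζ ∈ S, IsUnit ((Phat.map (PowerSeries.constantCoeff (R := A))).derivative.eval ζ) := by
    intro ζ hζ
    rw [hred, Polynomial.derivative_C_mul, Polynomial.eval_mul, Polynomial.eval_C]
    exact (Units.isUnit u⁻¹).mul (h1 ζ hζ)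
  -- Hensel splitting in `A⟦Y⟧[X]`
  obtain ⟨α, hαcc, hsplit⟩ :=
    eq_prod_X_sub_C_of_simple_roots Phat hPhat_monic S (hS.trans hPhat_deg.symm) h0' h1'
  -- the roots stay distinct in `Ω⟦Y⟧`
  have hinj : Set.InjOn (fun ζ => j (α ζ)) S := by
    intro a ha b hb hab
    have := congrArg (PowerSeries.coeff 0) hab
    simp only [hj, PowerSeries.coeff_map, PowerSeries.coeff_zero_eq_constantCoeff_apply, hαcc a ha,
      hαcc b hb] at this
    exact hι this
  have hsplitΩ : Phat.map j = ∏ ζ ∈ S, (Polynomial.X - Polynomial.C (j (α ζ))) := by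
    rw [hsplit, Polynomial.map_prod]
    simp
  -- now take a factorisation over `Ω`
  refine ⟨fun hunit => hirr.not_isUnit ?_, fun G H hGH => ?_⟩
  · -- a unit has degree 0, but `deg P ≥ 1` and the map preserves degrees
    have := Polynomial.natDegree_eq_zero_of_isUnit hunit
    rw [Polynomial.natDegree_map_eq_of_injective hιY_inj] at this
    omega
  · -- leading coefficients of `G` and `H` are units of `Ω[Y]`
    have hlcP : (P.map ιY).leadingCoeff = Polynomial.C (ι ℓ) := by
      rw [Polynomial.leadingCoeff_map_of_injective hιY_inj, hlc, hιY, Polynomial.coe_mapRingHom,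
        Polynomial.map_C]
    have hιℓ : IsUnit (ι ℓ) := by rw [← hu]; exact (Units.isUnit u).map ι
    have hlcGH : G.leadingCoeff * H.leadingCoeff = Polynomial.C (ι ℓ) := by
      rw [← Polynomial.leadingCoeff_mul, ← hGH, hlcP]
    have hlcG : IsUnit G.leadingCoeff :=
      isUnit_of_mul_isUnit_left (by rw [hlcGH]; exact hιℓ.map Polynomial.C)
    have hlcH : IsUnit H.leadingCoeff :=
      isUnit_of_mul_isUnit_right (by rw [hlcGH]; exact hιℓ.map Polynomial.C)
    by_contra hGHunit
    push Not at hGHunit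
    obtain ⟨hGu, hHu⟩ := hGHunit
    have hGdeg : 0 < G.natDegree := natDegree_pos_of_not_isUnit hlcG hGu
    have hHdeg : 0 < H.natDegree := natDegree_pos_of_not_isUnit hlcH hHu
    obtain ⟨uG, huG⟩ := hlcG
    obtain ⟨uH, huH⟩ := hlcH
    -- monic normalisations
    set Gm : Polynomial (Polynomial Ω) := Polynomial.C (↑uG⁻¹ : Polynomial Ω) * G with hGm
    set Hm : Polynomial (Polynomial Ω) := Polynomial.C (↑uH⁻¹ : Polynomial Ω) * H with hHm
    have hGm_monic : Gm.Monic :=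
      Polynomial.monic_C_mul_of_mul_leadingCoeff_eq_one (by rw [← huG, Units.inv_mul])
    have hHm_monic : Hm.Monic :=
      Polynomial.monic_C_mul_of_mul_leadingCoeff_eq_one (by rw [← huH, Units.inv_mul])
    have hGm_deg : Gm.natDegree = G.natDegree := by
      rw [hGm, Polynomial.natDegree_C_mul (Units.ne_zero _)]
    have hHm_deg : Hm.natDegree = H.natDegree := by
      rw [hHm, Polynomial.natDegree_C_mul (Units.ne_zero _)]
    -- `Gm * Hm = ℓ⁻¹ P` over `Ω`
    have hPmΩ : Pm.map ιY = Gm * Hm := by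
      have hP0' : P.map ιY ≠ 0 := fun h => hP0 (hιYX_inj (by rw [h, Polynomial.map_zero]))
      have hmon1 : (Pm.map ιY).Monic := hPm_monic.map _
      have hmon2 : (Gm * Hm).Monic := hGm_monic.mul hHm_monic
      have e1 : Pm.map ιY = Polynomial.C (ιY (Polynomial.C (↑u⁻¹ : A))) * P.map ιY := by
        rw [hPm, Polynomial.map_mul, Polynomial.map_C]
      have e2 : Gm * Hm = Polynomial.C ((↑uG⁻¹ : Polynomial Ω) * ↑uH⁻¹) * P.map ιY := by
        rw [hGm, hHm, hGH, Polynomial.C_mul]; ring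
      -- compare the constants through the leading coefficients
      have hc : ιY (Polynomial.C (↑u⁻¹ : A)) = (↑uG⁻¹ : Polynomial Ω) * ↑uH⁻¹ := by
        have l1 := hmon1.leadingCoeff
        have l2 := hmon2.leadingCoeff
        rw [e1, Polynomial.leadingCoeff_mul, Polynomial.leadingCoeff_C] at l1
        rw [e2, Polynomial.leadingCoeff_mul, Polynomial.leadingCoeff_C] at l2
        have hne : (P.map ιY).leadingCoeff ≠ 0 := Polynomial.leadingCoeff_ne_zero.2 hP0'
        exact mul_right_cancel₀ hne (l1.trans l2.symm)
      rw [e1, e2, hc]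
    -- pass to power series over `Ω`: `Gm` divides the split product
    have hPhatΩ : Phat.map j = (Pm.map ιY).map coeΩ := by
      rw [hPhat, Polynomial.map_map, Polynomial.map_map, hj, hcoeA, powerSeries_map_comp_coe]
    have hGdvd : Gm.map coeΩ ∣ ∏ ζ ∈ S, (Polynomial.X - Polynomial.C (j (α ζ))) :=
      ⟨Hm.map coeΩ, by rw [← Polynomial.map_mul, ← hPmΩ, ← hPhatΩ, hsplitΩ]⟩
    have hHdvd : Hm.map coeΩ ∣ ∏ ζ ∈ S, (Polynomial.X - Polynomial.C (j (α ζ))) :=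
      ⟨Gm.map coeΩ, by rw [mul_comm, ← Polynomial.map_mul, ← hPmΩ, ← hPhatΩ, hsplitΩ]⟩
    obtain ⟨SG, -, hSG⟩ :=
      exists_subset_of_monic_dvd_prod S (fun ζ => j (α ζ)) hinj (hGm_monic.map coeΩ) hGdvd
    obtain ⟨SH, -, hSH⟩ :=
      exists_subset_of_monic_dvd_prod S (fun ζ => j (α ζ)) hinj (hHm_monic.map coeΩ) hHdvd
    -- so their coefficients come from `A⟦Y⟧`, hence from `A[Y]`
    have hSG' : Gm.map coeΩ = (∏ ζ ∈ SG, (Polynomial.X - Polynomial.C (α ζ))).map j := by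
      rw [hSG, Polynomial.map_prod]; simp
    have hSH' : Hm.map coeΩ = (∏ ζ ∈ SH, (Polynomial.X - Polynomial.C (α ζ))).map j := by
      rw [hSH, Polynomial.map_prod]; simp
    obtain ⟨G₀, hG₀, -⟩ := exists_map_mapRingHom_eq ι hι Gm _ hSG'
    obtain ⟨H₀, hH₀, -⟩ := exists_map_mapRingHom_eq ι hι Hm _ hSH'
    rw [← hιY] at hG₀ hH₀
    -- the factorisation descends: `P = (ℓ G₀) H₀` in `A[Y][X]`
    have e3 : P = Polynomial.C (Polynomial.C ℓ) * Pm := by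
      rw [hPm, ← mul_assoc, ← Polynomial.C_mul, ← Polynomial.C_mul, ← hu, Units.mul_inv,
        Polynomial.C_1, Polynomial.C_1, one_mul]
    have hfac : P = (Polynomial.C (Polynomial.C ℓ) * G₀) * H₀ := by
      apply hιYX_inj
      rw [Polynomial.map_mul, Polynomial.map_mul, hG₀, hH₀, mul_assoc, ← hPmΩ, ← Polynomial.map_mul,
        ← e3]
    -- contradiction with irreducibility: both factors have positive degree
    have hG₀deg : 0 < G₀.natDegree := by
      rw [← Polynomial.natDegree_map_eq_of_injective hιY_inj G₀, hG₀, hGm_deg]; exact hGdeg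
    have hH₀deg : 0 < H₀.natDegree := by
      rw [← Polynomial.natDegree_map_eq_of_injective hιY_inj H₀, hH₀, hHm_deg]; exact hHdeg
    rcases hirr.isUnit_or_isUnit hfac with h | h
    · have := Polynomial.natDegree_eq_zero_of_isUnit h
      rw [Polynomial.natDegree_C_mul (Polynomial.C_ne_zero.2 (hu ▸ Units.ne_zero u))] at this
      omega
    · have := Polynomial.natDegree_eq_zero_of_isUnit h
      omega

end Literature.RingTheory.MvPolynomial

end
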